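import Summits.AtomisticToContinuum.Crystallization.Theorems.FluxTubeKeplerFloorGivesLayered
import Summits.AtomisticToContinuum.Crystallization.Theorems.FluxTubeKeplerFluxCellKeplerSingleScale
import Summits.AtomisticToContinuum.Crystallization.Theorems.ChessboardParticlePlanesPeriodicWindowsIffCrystallization
import Summits.AtomisticToContinuum.Crystallization.Theorems.FluxTubeKeplerKeplerEnergyFloor

/-!
# Line `AffineBlindRung` (affine / elastic-strain ladder) — skeleton for the forward rung over
`FluxTubeKepler.FloorGivesLayered` (crux dir `FluxCellKepler`, stmt-AtomisticToContinuum-15221; fwd-rung G1 gen 9,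
seed g1-AtomisticToContinuum-15223)

FLOOR (proved, `FluxTubeKeplerFloorGivesLayered.FloorGivesLayered_proof`): for every periodic `P₀`, the energy floor
`N·e(P₀) ≤ E(x)` on Lennard-Jones ground states together with the defect BUDGET — at every scale `(R, η)` some `c > 0`
prices every site whose `R`-neighbourhood is not two-way `η`-close to an admissible layered template (spacing
`a ∈ [47/50, 1]`, Hägg word, Barlow registry, gaps in `[39a/50, 17a/20]`, rigid motion `A`) — forces layered windows,
hence (proved `PeriodicGivenLayered`) periodic windows, along every ground-state sequence.

RUNG (`AffineBlindRung := ∃ κ > 0, AffRung κ`): the budget need only price the sites whose `R`-neighbourhood is not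
`η`-close to an admissible template deformed by SOME HOMOGENEOUS LINEAR STRAIN `M` with `‖M − 1‖ ≤ κ` (template points
`A (M p)`): uniformly sheared, tilted-and-sheared, slightly over-compressed or over-stretched perfect material is FREE
at every site.  A Kepler-type certificate then never has to charge a site for the elastic STRAIN of the perfect
material around it; the strain of the windows is selected by the energy (elastic rigidity — Born stability — of the
admissible Barlow family, and the `C₃ᵥ` symmetry of every Barlow stacking, which kills the term linear in shear).
Dial `AffRung κ` (`κ` = largest unpriced strain): `AffRung 0` is the floor (`affRung_zero`, F3: `‖M − 1‖ ≤ 0` forces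
`M = 1`), antitone dial `affRung_anti` (harder-to-easier = shrinking `κ`), on-path `affRung_of_crystallization` /
`AffineBlindRung_of_Crystallization` (F4, landed iff `periodicWindows_of_crystallization`).

WHY THE FLOOR'S PROOF STOPS: Step 1 of the seed (`eventually_exists_not_bad`) now yields good sites whose templates
carry a scale-dependent strain `M_k` with `‖M_k − 1‖ ≤ κ`; Steps 2–3 (`spacing_selection` by Bolzano–Weierstrass on
the spacing, `match_dilate` by DILATION covariance) have no covariance to trade a strain against: the layered datum
of `PeriodicGivenLayered` (triangular layers of ONE spacing, Barlow registry, gaps in the box) is not closed under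
any non-conformal linear map, and at radius `R` a strain of size `κ` displaces template points by `κR ≫ η`.  No
potential-free repair exists: the uniformly sheared Barlow stack `M • P_hcp` (`M = 1 + κ/2 · (e₁ ⊗ e₂ + e₂ ⊗ e₁)`)
is affine-good at every site and layered-good at no site once `R > 2η/κ`.  The missing input is ENERGY: a
Lennard-Jones ground state is not a sheared crystal because shear costs `μ · strain²` per particle (`μ > 0`).

THE LINE (three stubs, the only `sorry`s; composition `AffineBlindRung_of` sorry-free):
* `stub_affineGap` (THE NEW INPUT, configuration-free: certified lattice-sum numerics + symmetry): for some `κ₀ > 0`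
  and every locality `(ζ, ρ)` there are `g > 0`, `C` with
  `Σ_{p∈W} e_p(S) ≥ 2e*·#W + 2g·#{p ∈ W : ¬Near ζ ρ S p} − C·∂W` for every finite window `W` of every strained
  admissible template `S = A M T` (`‖M − 1‖ ≤ κ₀`) — each site whose `ρ`-environment in `S` is NOT `ζ`-close to an
  admissible (unstrained, in-box) template pays `g`; in the window-bound currency of the landed
  `LayeredHull.stub_windowBounds` (which gives the `g = 0` statement for every separated set).
* `stub_nearGood` (potential-free matching composition, the cheap end): a particle matched (tolerance `η'`, radius
  `R'`) to a point `q` of the strained template of an affine-good site, at which the template IS `Near ζ ρ`, is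
  floor-good at scale `(2, η)` whenever `2η' + ζ ≤ η`, `2 + η ≤ ρ`, `‖q‖ + ρ + 1 ≤ R'`.
* `stub_affineSelection` (Lennard-Jones block accounting along ground states; load-bearing analysis): given the two
  previous statements, along a ground-state sequence whose `κ₀`-affine defects are sparse at every scale the radius-2
  floor defects are sparse too (`E(x_N) ≤ N·e* + o(N)` by `crysEnergyLimit`; blocks covered by a strained template pay
  `g` per non-`Near` matched site by Stub 1 and their `Near`-matched particles are floor-good by Stub 2).
Glue (proved here): monotonicity in `κ`, `affGood_zero_iff` (`κ = 0` is the floor's predicate), `fewAffBad_of_budget`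
(counting, as the seed's `eventually_exists_not_bad` with a density `θ`), `good_of_sparse` (landed chart gluing
`FluxCellKeplerSingleScale.card_bad_le` + `LennardJonesMinimalDistance_holds`, verbatim from the sibling lines),
`hasLayeredWindows_of_good` (Steps 2–3 of the seed, verbatim from the sibling lines), proved `PeriodicGivenLayered`.
-/

noncomputable section

namespace Summit.AtomisticToContinuum.Crystallization.Cruxes.FluxCellKepler.AffineLadder

open scoped BigOperators Classical
open Filter Topology
open Literature.MathematicalPhysics.StatisticalMechanics
open Summit.AtomisticToContinuum.Crystallization.Theorems.FluxCellKeplerSingleScale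
  (LayeredGood layeredGood_mono card_bad_le)
open Summit.AtomisticToContinuum.Crystallization.Theorems.ChargedEnergyGapNegative
  (eStar card_mul_eStar_le crysEnergyLimit)

local notation "E3" => EuclideanSpace ℝ (Fin 3)

/-- FLOOR(P₀): `N · e(P₀) ≤ E(x)` for every Lennard-Jones ground state (verbatim the floor's first hypothesis). -/
def Floor (P₀ : PeriodicConfiguration 3) : Prop :=
  ∀ (N : ℕ) (x : Fin N → E3), IsGroundState lennardJones x →
    (N : ℝ) * P₀.energyPerParticle lennardJones ≤ interactionEnergy lennardJones x

/-- `κ`-AFFINE-GOOD SITE: some admissible layered template (spacing `a ∈ [47/50, 1]`, Hägg word `s`, Barlow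
registry, gaps in `[39a/50, 17a/20]`, rigid motion `A`) deformed by a homogeneous linear STRAIN `M` with
`‖M − 1‖ ≤ κ` — template points `A (M p)` — matches the `R`-ball around `x i` two-way with tolerance `η`.
`κ = 0`: `M = 1`, the floor's predicate `LayeredGood R η` (`affGood_zero_iff`). -/
def AffGood (κ R η : ℝ) {N : ℕ} (x : Fin N → E3) (i : Fin N) : Prop :=
  ∃ M : E3 →L[ℝ] E3, ‖M - 1‖ ≤ κ ∧
  ∃ a : ℝ, 47 / 50 ≤ a ∧ a ≤ 1 ∧ ∃ (A : E3 →ₗᵢ[ℝ] E3) (s : ℤ → ℤ) (z : ℤ → ℝ), IsHaggSeq s ∧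
    (∀ m : ℤ, 39 / 50 * a ≤ z (m + 1) - z m ∧ z (m + 1) - z m ≤ 17 / 20 * a) ∧
    let S : Set E3 := {p | ∃ m k l : ℤ, p = A (M (((k : ℝ) • triangularVec₁ a) + ((l : ℝ) • triangularVec₂ a) +
      ((haggLabel s m : ℝ) • barlowOffset a) + (z m • layerNormal 1)))}
    (∀ p ∈ S, ‖p‖ ≤ R → ∃ j : Fin N, dist (x j - x i) p ≤ η) ∧
    (∀ j : Fin N, ‖x j - x i‖ ≤ R → ∃ p ∈ S, dist (x j - x i) p ≤ η)

/-- AFFINE-BLIND BUDGET with dial `κ`: at every scale `(R,η)` some `c > 0` prices the sites that are not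
`κ`-affine-good against the excess energy over `N · e(P₀)` (`κ = 0`: the floor's budget). -/
def AffBudget (κ : ℝ) (P₀ : PeriodicConfiguration 3) : Prop :=
  ∀ R η : ℝ, 0 < R → 0 < η → ∃ c : ℝ, 0 < c ∧
    ∀ (N : ℕ) (x : Fin N → E3), IsGroundState lennardJones x →
      c * (Nat.card {i : Fin N // ¬ AffGood κ R η x i} : ℝ) ≤
        interactionEnergy lennardJones x - (N : ℝ) * P₀.energyPerParticle lennardJones

/-- Periodic windows at every scale along `x` (verbatim the conclusion of `FluxTubeKepler.PeriodicGivenLayered`). -/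
def HasPeriodicWindows (x : (N : ℕ) → (Fin N → E3)) : Prop :=
  ∃ P : PeriodicConfiguration 3, ∀ R ε : ℝ, 0 < ε → ∃ᶠ N in atTop, ∃ t : E3,
    (∀ s ∈ P.points, ‖s‖ ≤ R → ∃ i : Fin N, dist (x N i + t) s ≤ ε) ∧
    (∀ i : Fin N, ‖x N i + t‖ ≤ R → ∃ s ∈ P.points, dist (x N i + t) s ≤ ε)

/-- **The graded family.** `AffRung κ`: FLOOR and the budget that leaves strains of size `≤ κ` unpriced force
periodic windows along every Lennard-Jones ground-state sequence. -/
def AffRung (κ : ℝ) : Prop :=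
  ∀ P₀ : PeriodicConfiguration 3, Floor P₀ → AffBudget κ P₀ →
    ∀ x : (N : ℕ) → (Fin N → E3), (∀ N, IsGroundState lennardJones (x N)) → HasPeriodicWindows x

/-- **Deciding rung.** For SOME positive strain allowance `κ` the budget need not price the elastic STRAIN of the
perfect material at all: pricing only the sites whose `R`-neighbourhood is not `η`-close to an admissible layered
template deformed by a homogeneous strain of size `≤ κ` suffices — the strain of the windows (zero) is then selected
by the energy. -/
def AffineBlindRung : Prop := ∃ κ : ℝ, 0 < κ ∧ AffRung κ

/-! ## Predicate bookkeeping -/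

theorem affGood_mono {κ κ' : ℝ} (hκ : κ ≤ κ') {R η : ℝ} {N : ℕ} (x : Fin N → E3) (i : Fin N) :
    AffGood κ R η x i → AffGood κ' R η x i := by
  rintro ⟨M, hM, a, ha₁, ha₂, A, s, z, hs, hz, h₁, h₂⟩
  exact ⟨M, hM.trans hκ, a, ha₁, ha₂, A, s, z, hs, hz, h₁, h₂⟩

theorem layeredGood_of_affGood_zero {R η : ℝ} {N : ℕ} (x : Fin N → E3) (i : Fin N) :
    AffGood 0 R η x i → LayeredGood R η x i := by
  rintro ⟨M, hM, a, ha₁, ha₂, A, s, z, hs, hz, h₁, h₂⟩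
  have hM1 : M = 1 := sub_eq_zero.mp (norm_le_zero_iff.mp hM)
  subst hM1
  refine ⟨a, ha₁, ha₂, A, s, z, hs, hz, ?_, ?_⟩
  · intro p hp hpR
    obtain ⟨m, k, l, rfl⟩ := hp
    exact h₁ _ ⟨m, k, l, by simp⟩ hpR
  · intro j hj
    obtain ⟨p, hp, hjp⟩ := h₂ j hj
    obtain ⟨m, k, l, rfl⟩ := hp
    exact ⟨_, ⟨m, k, l, rfl⟩, by simpa using hjp⟩

theorem affGood_zero_of_layeredGood {R η : ℝ} {N : ℕ} (x : Fin N → E3) (i : Fin N) :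
    LayeredGood R η x i → AffGood 0 R η x i := by
  rintro ⟨a, ha₁, ha₂, A, s, z, hs, hz, h₁, h₂⟩
  refine ⟨1, by simp, a, ha₁, ha₂, A, s, z, hs, hz, ?_, ?_⟩
  · intro p hp hpR
    obtain ⟨m, k, l, rfl⟩ := hp
    exact h₁ _ ⟨m, k, l, by simp⟩ (by simpa using hpR)
  · intro j hj
    obtain ⟨p, hp, hjp⟩ := h₂ j hj
    obtain ⟨m, k, l, rfl⟩ := hp
    exact ⟨_, ⟨m, k, l, rfl⟩, by simpa using hjp⟩

/-- The floor's predicate is the member `κ = 0` of the family (`‖M − 1‖ ≤ 0 ↔ M = 1`). -/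
theorem affGood_zero_iff {R η : ℝ} {N : ℕ} (x : Fin N → E3) (i : Fin N) :
    AffGood 0 R η x i ↔ LayeredGood R η x i :=
  ⟨layeredGood_of_affGood_zero x i, affGood_zero_of_layeredGood x i⟩

/-- `AffGood κ` is antitone in the radius and monotone in the tolerance. [folklore] -/
theorem affGood_mono_scale {κ R R' η η' : ℝ} (hR : R ≤ R') (hη : η' ≤ η) {N : ℕ}
    (x : Fin N → E3) (i : Fin N) : AffGood κ R' η' x i → AffGood κ R η x i := by
  rintro ⟨M, hM, a, ha₁, ha₂, A, s, z, hs, hz, h₁, h₂⟩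
  refine ⟨M, hM, a, ha₁, ha₂, A, s, z, hs, hz, ?_, ?_⟩
  · intro p hp hpR
    obtain ⟨j, hj⟩ := h₁ p hp (hpR.trans hR)
    exact ⟨j, hj.trans hη⟩
  · intro j hj
    obtain ⟨p, hp, hjp⟩ := h₂ j (hj.trans hR)
    exact ⟨p, hp, hjp.trans hη⟩

/-- The budget is monotone in the dial: a budget pricing the larger bad set prices the smaller one. -/
theorem affBudget_mono {κ κ' : ℝ} (hκ : κ ≤ κ') (P₀ : PeriodicConfiguration 3) :
    AffBudget κ P₀ → AffBudget κ' P₀ := by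
  intro hB R η hR hη
  obtain ⟨c, hc, hcB⟩ := hB R η hR hη
  refine ⟨c, hc, fun N x hx => le_trans ?_ (hcB N x hx)⟩
  have hle : Nat.card {i : Fin N // ¬ AffGood κ' R η x i} ≤ Nat.card {i : Fin N // ¬ AffGood κ R η x i} := by
    rw [Nat.card_eq_fintype_card, Nat.card_eq_fintype_card]
    exact Fintype.card_subtype_mono _ _ fun i hi hg => hi (affGood_mono hκ x i hg)
  exact mul_le_mul_of_nonneg_left (by exact_mod_cast hle) hc.le

/-! ## F3 — the family specialises to the proved floor -/

/-- `AffRung 0` is the floor: the seed theorem followed by the proved `PeriodicGivenLayered`. -/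
theorem affRung_zero : AffRung 0 := by
  intro P₀ hF hB x hx
  refine Theses.FluxTubeKepler.PeriodicGivenLayered_holds x hx
    (Theorems.FluxTubeKeplerFloorGivesLayered.FloorGivesLayered_proof P₀ hF ?_ x hx)
  intro R η hR hη
  obtain ⟨c, hc, hcB⟩ := hB R η hR hη
  refine ⟨c, hc, fun N y hy => ?_⟩
  show c * (Nat.card {i : Fin N // ¬ LayeredGood R η y i} : ℝ) ≤ _
  refine le_trans ?_ (hcB N y hy)
  have hle : Nat.card {i : Fin N // ¬ LayeredGood R η y i} ≤
      Nat.card {i : Fin N // ¬ AffGood 0 R η y i} := by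
    rw [Nat.card_eq_fintype_card, Nat.card_eq_fintype_card]
    exact Fintype.card_subtype_mono _ _ fun i hi hg => hi (layeredGood_of_affGood_zero y i hg)
  exact mul_le_mul_of_nonneg_left (by exact_mod_cast hle) hc.le

/-! ## Dial monotonicity (harder-to-easier = shrinking the unpriced strain allowance `κ`) -/

theorem affRung_anti {κ κ' : ℝ} (hκ : κ ≤ κ') : AffRung κ' → AffRung κ :=
  fun H P₀ hF hB x hx => H P₀ hF (affBudget_mono hκ P₀ hB) x hx

/-- The deciding rung gives every member `AffRung κ'` with `κ'` at most its witness, in particular the floor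
(informational `specialises`). -/
theorem affRung_zero_of_affineBlindRung (h : AffineBlindRung) : AffRung 0 := by
  obtain ⟨κ, hκ, hR⟩ := h
  exact affRung_anti hκ.le hR

/-! ## F4 — on-path lemmas: the sub-problem implies every member -/

theorem affRung_of_crystallization (κ : ℝ) (h : _root_.Crystallization) : AffRung κ :=
  fun _ _ _ x hx =>
    Theorems.ChessboardParticlePlanesPeriodicWindowsIffCrystallization.periodicWindows_of_crystallization h x hx

@[aesop safe apply]
theorem AffineBlindRung_of_Crystallization (h : _root_.Crystallization) : AffineBlindRung :=
  ⟨1, one_pos, affRung_of_crystallization 1 h⟩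

/-! ## How the rung relieves the parent crux `FluxCellKepler` (documentation, sorry-free) -/

/-- The floor-and-`κ`-affine-blind-budget package (what a Kepler-type certificate that never has to charge a site for
a homogeneous strain of size `≤ κ` delivers). -/
def AffKeplerFloor (κ : ℝ) : Prop := ∃ P₀ : PeriodicConfiguration 3, Floor P₀ ∧ AffBudget κ P₀

theorem affKeplerFloor_mono {κ κ' : ℝ} (hκ : κ ≤ κ') : AffKeplerFloor κ → AffKeplerFloor κ' := by
  rintro ⟨P₀, hF, hB⟩
  exact ⟨P₀, hF, affBudget_mono hκ P₀ hB⟩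

theorem windows_of_affRung {κ : ℝ} (h : AffRung κ) (hK : AffKeplerFloor κ) :
    ∀ x : (N : ℕ) → (Fin N → E3), (∀ N, IsGroundState lennardJones (x N)) → HasPeriodicWindows x := by
  obtain ⟨P₀, hF, hB⟩ := hK
  exact fun x hx => h P₀ hF hB x hx

/-- The parent crux gives the package at `κ = 0` (proved `KeplerEnergyFloor` + minimal distance), hence at every
`κ ≥ 0`. -/
theorem affKeplerFloor_zero_of_fluxCellKepler (hK : Theses.FluxTubeKepler.FluxCellKepler) : AffKeplerFloor 0 := by
  obtain ⟨P₀, hF, hB⟩ := Theorems.keplerEnergyFloor_proof hK LennardJonesMinimalDistance_holds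
  refine ⟨P₀, hF, fun R η hR hη => ?_⟩
  obtain ⟨c, hc, hcB⟩ := hB R η hR hη
  refine ⟨c, hc, fun N y hy => ?_⟩
  have hcB' : c * (Nat.card {i : Fin N // ¬ LayeredGood R η y i} : ℝ) ≤
      interactionEnergy lennardJones y - (N : ℝ) * P₀.energyPerParticle lennardJones := hcB N y hy
  refine le_trans ?_ hcB'
  have hle : Nat.card {i : Fin N // ¬ AffGood 0 R η y i} ≤
      Nat.card {i : Fin N // ¬ LayeredGood R η y i} := by
    rw [Nat.card_eq_fintype_card, Nat.card_eq_fintype_card]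
    exact Fintype.card_subtype_mono _ _ fun i hi hg => hi (affGood_zero_of_layeredGood y i hg)
  exact mul_le_mul_of_nonneg_left (by exact_mod_cast hle) hc.le


/-! ## The line: strain selection from energy (elastic rigidity of the admissible family)

Currency.  For a set `S ⊆ ℝ³` and `p ∈ S` the SITE ENERGY is `e_p(S) = Σ'_{q ∈ S, q ≠ p} V_LJ(|p − q|)` and the
boundary weight of a finite window `W ⊆ S` is `∂W = Σ_{p∈W} (1 + dist(p, S∖W))⁻³` — exactly the currency of the
landed window bounds `LayeredHull.stub_windowBounds` ((L): `Σ_W e_p ≥ 2E(#W) − C∂W` for separated sets), with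
`N·e* ≤ E(N)` (`card_mul_eStar_le`). -/

/-- `Near ζ ρ S q`: seen from the point `q`, the set `S` is two-way `ζ`-close on the `ρ`-ball to an ADMISSIBLE
(unstrained: spacing in `[47/50, 1]`, gaps in the box, Barlow registry, rigid motion) layered template — the floor's
template family.  For an admissible unstrained `S` and `q ∈ S` it holds with `ζ = 0` (re-index the template at `q`). -/
def Near (ζ ρ : ℝ) (S : Set E3) (q : E3) : Prop :=
  ∃ a : ℝ, 47 / 50 ≤ a ∧ a ≤ 1 ∧ ∃ (A : E3 →ₗᵢ[ℝ] E3) (s : ℤ → ℤ) (z : ℤ → ℝ), IsHaggSeq s ∧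
    (∀ m : ℤ, 39 / 50 * a ≤ z (m + 1) - z m ∧ z (m + 1) - z m ≤ 17 / 20 * a) ∧
    let T : Set E3 := {p | ∃ m k l : ℤ, p = A (((k : ℝ) • triangularVec₁ a) + ((l : ℝ) • triangularVec₂ a) +
      ((haggLabel s m : ℝ) • barlowOffset a) + (z m • layerNormal 1))}
    (∀ p' ∈ T, ‖p'‖ ≤ ρ → ∃ p ∈ S, dist (p - q) p' ≤ ζ) ∧
    (∀ p ∈ S, ‖p - q‖ ≤ ρ → ∃ p' ∈ T, dist (p - q) p' ≤ ζ)

/-- AFFINE DEFECTS ARE SPARSE along `x`: at every scale `(R, η)` and every density `θ > 0`, eventually at most `θN`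
sites are not `κ`-affine-good (what FLOOR + the affine-blind budget deliver, `fewAffBad_of_budget`). -/
def FewAffBad (κ : ℝ) (x : (N : ℕ) → (Fin N → E3)) : Prop :=
  ∀ R η θ : ℝ, 0 < R → 0 < η → 0 < θ →
    ∀ᶠ N in atTop, (Nat.card {i : Fin N // ¬ AffGood κ R η (x N) i} : ℝ) ≤ θ * N

/-- ELASTIC GAP AT STRAIN ALLOWANCE `κ` (the statement of Stub 1 at a given `κ`): for every locality `(ζ, ρ)` there
are `g > 0` and `C` such that every finite window `W` of every `κ`-strained admissible template `S` satisfies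
`Σ_{p∈W} e_p(S) ≥ 2e*·#W + 2g·#{p ∈ W : ¬ Near ζ ρ S p} − C·∂W`. -/
def AffineGapAt (κ : ℝ) : Prop :=
  ∀ ζ ρ : ℝ, 0 < ζ → 0 < ρ → ∃ g C : ℝ, 0 < g ∧
    ∀ M : E3 →L[ℝ] E3, ‖M - 1‖ ≤ κ →
    ∀ a : ℝ, 47 / 50 ≤ a → a ≤ 1 → ∀ (A : E3 →ₗᵢ[ℝ] E3) (s : ℤ → ℤ) (z : ℤ → ℝ), IsHaggSeq s →
      (∀ m : ℤ, 39 / 50 * a ≤ z (m + 1) - z m ∧ z (m + 1) - z m ≤ 17 / 20 * a) →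
      let S : Set E3 := {p | ∃ m k l : ℤ, p = A (M (((k : ℝ) • triangularVec₁ a) + ((l : ℝ) • triangularVec₂ a) +
        ((haggLabel s m : ℝ) • barlowOffset a) + (z m • layerNormal 1)))}
      ∀ W : Finset E3, (↑W : Set E3) ⊆ S →
        2 * eStar * (W.card : ℝ) + 2 * g * ((W.filter fun p => ¬ Near ζ ρ S p).card : ℝ) -
            C * ∑ p ∈ W, (1 + Metric.infDist p (S \ (↑W : Set E3)))⁻¹ ^ 3 ≤
          ∑ p ∈ W, (∑' q : {q : E3 // q ∈ S ∧ q ≠ p}, lennardJones (dist p (q : E3)))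

/-! ### The stub statements as named propositions (verbatim; later stubs take earlier ones as hypotheses) -/

/-- Statement of `stub_affineGap` (verbatim; see there). [conjecture] -/
def Sig.stub_affineGap : Prop := ∃ κ₀ : ℝ, 0 < κ₀ ∧ κ₀ ≤ 1 / 4 ∧ AffineGapAt κ₀

/-- Statement of `stub_nearGood` (verbatim; see there). [folklore] -/
def Sig.stub_nearGood : Prop :=
    ∀ (R' η' ζ ρ η : ℝ), 0 ≤ η' → η' ≤ 1 → 0 ≤ ζ → ζ ≤ 1 → 2 * η' + ζ ≤ η → 2 + η ≤ ρ →
    ∀ (N : ℕ) (x : Fin N → E3) (i : Fin N) (M : E3 →L[ℝ] E3) (a : ℝ) (A : E3 →ₗᵢ[ℝ] E3) (s : ℤ → ℤ)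
      (z : ℤ → ℝ), 47 / 50 ≤ a → a ≤ 1 → IsHaggSeq s →
      (∀ m : ℤ, 39 / 50 * a ≤ z (m + 1) - z m ∧ z (m + 1) - z m ≤ 17 / 20 * a) →
      let S : Set E3 := {p | ∃ m k l : ℤ, p = A (M (((k : ℝ) • triangularVec₁ a) + ((l : ℝ) • triangularVec₂ a) +
        ((haggLabel s m : ℝ) • barlowOffset a) + (z m • layerNormal 1)))}
      (∀ p ∈ S, ‖p‖ ≤ R' → ∃ j : Fin N, dist (x j - x i) p ≤ η') →
      (∀ j : Fin N, ‖x j - x i‖ ≤ R' → ∃ p ∈ S, dist (x j - x i) p ≤ η') →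
      ∀ (j : Fin N) (q : E3), q ∈ S → dist (x j - x i) q ≤ η' → ‖q‖ + ρ + 1 ≤ R' → Near ζ ρ S q →
        LayeredGood 2 η x j

/-- Statement of `stub_affineSelection` (verbatim; see there). [conjecture] -/
def Sig.stub_affineSelection : Prop := ∀ κ : ℝ, 0 < κ → κ ≤ 1 / 4 → AffineGapAt κ → Sig.stub_nearGood →
    ∀ x : (N : ℕ) → (Fin N → E3), (∀ N, IsGroundState lennardJones (x N)) → FewAffBad κ x →
      ∀ η θ : ℝ, 0 < η → 0 < θ →
        ∀ᶠ N in atTop, (Nat.card {i : Fin N // ¬ LayeredGood 2 η (x N) i} : ℝ) ≤ θ * N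

/-! ### The declared stubs (the only `sorry`s of the file) -/

/-- **Stub 1 — elastic gap of the strained admissible Lennard-Jones lattice sums (THE NEW INPUT; load-bearing;
configuration-free).**  There is a strain allowance `κ₀ ∈ (0, 1/4]` such that for every locality `(ζ, ρ)` some
`g > 0` and `C` satisfy: for every linear `M` with `‖M − 1‖ ≤ κ₀`, every admissible layered datum (spacing
`a ∈ [47/50, 1]`, rigid motion `A`, Hägg word `s`, gaps in `[39a/50, 17a/20]`) with strained template
`S = {A (M p)}`, and every finite window `W ⊆ S`,
`Σ_{p∈W} e_p(S) ≥ 2e*·#W + 2g·#{p ∈ W : ¬ Near ζ ρ S p} − C·Σ_{p∈W}(1 + dist(p, S∖W))⁻³`.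
Intended proof (`V(r) = r⁻¹²/12 − r⁻⁶/6`): (i) polar-decompose `M = Q(1 + ε)`, `Q` a rotation (absorbed into `A`),
`ε` symmetric, and split `ε = ε_abs + ε_sh` into the part ABSORBED by the family (in-plane isotropic → spacing,
normal stretch → gaps) and the SHEAR part (in-plane traceless, out-of-plane shear: `4` components); (ii) every Barlow
stacking has the point symmetry `C₃ᵥ` (three-fold axis along the normal, vertical mirrors) at every site, and both
shear types transform in its `E`-representation, so the per-layer energy has NO term linear in `ε_sh` and no
`A₁ × E` cross term: `e_m(S) = e_m(T̃) + Q_m(ε_sh) + O(|ε|³)` with `T̃` the template with absorbed spacing/gaps;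
(iii) BORN STABILITY, certified by interval lattice sums over the compact datum space (`a` in the box, adjacent gap
pairs in the box, the three registry types of second-neighbour layers — interactions beyond decay like `H⁻⁴`):
`Q_m(ε_sh) ≥ μ|ε_sh|²` with a uniform `μ > 0` near the energy-minimising data, while data away from the minimiser
have `e(T̃) ≥ e* + margin` (the equation of state / gap convexity: the in-box minimiser `a* ≈ 0.971`,
`gap* ≈ 0.816a` is interior and non-degenerate; out-of-box absorbed components only raise the energy further or are
dominated by the margin) — only `e* ≤ e(explicit Barlow stack)` enters, never the unknown value of `e*`;
(iv) blame assignment: a site `p` with `¬ Near ζ ρ S p` has `|ε_sh| ≥ ζ/(c ρ)`, or an absorbed overshoot of the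
spacing / of a gap within distance `ρ` of `p` beyond the box by `≥ ζ/(cρ)`; the first costs `μ ζ²/(cρ)²` at every
site, the second costs at every site (EOS slope at the box edge is outward), the third is paid by the two layers
adjacent to that gap and blamed by at most `2ρ/gap + 1` layers; per-layer import/export of energy between adjacent
layers (first order in gap differences) is what the boundary weight `C·∂W` absorbs at the top and bottom layers of
`W` (every `p` there has `dist(p, S∖W) ≤ a`, weight `≥ (1 + a)⁻³ ≥ 1/8`).  May fail if some admissible near-optimal
Barlow stacking were SHEAR-SOFT under Lennard-Jones (a vanishing shear modulus `c₄₄` or `c₆₆` somewhere on the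
e*-attaining part of the datum space — numerically both are `≈ 2–5` in these units at `a*`, and the statement needs
them only where `e(T̃) − e*` is below the EOS margin), or through the `κ₀`-smallness needed to dominate the cubic
remainder (hence `∃ κ₀`, not a named constant). [conjecture] -/
theorem stub_affineGap : ∃ κ₀ : ℝ, 0 < κ₀ ∧ κ₀ ≤ 1 / 4 ∧ AffineGapAt κ₀ := by
  sorry

/-- **Stub 2 — Near-matched particles are floor-good (potential-free matching composition; the cheap end).**
If the `R'`-ball around `x i` is two-way `η'`-matched with a strained template `S`, `x j − x i` is `η'`-close to a
point `q ∈ S` with `‖q‖ + ρ + 1 ≤ R'`, and `S` seen from `q` is `Near ζ ρ` an admissible template `T`, then `j` is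
`(2, η)`-layered-good (template `T`) as soon as `2η' + ζ ≤ η`, `2 + η ≤ ρ`, `η', ζ ≤ 1`.  Intended proof: two
triangle inequalities — a point `p' ∈ T` with `‖p'‖ ≤ 2 ≤ ρ` has `p ∈ S` with `dist(p − q, p') ≤ ζ`, `‖p‖ ≤
‖q‖ + 2 + ζ ≤ R'`, hence a particle `j'` with `dist(x j' − x i, p) ≤ η'`, and `dist(x j' − x j, p') ≤ η' + η' + ζ`;
conversely a particle `j'` with `‖x j' − x j‖ ≤ 2` has `‖x j' − x i‖ ≤ 2 + ‖q‖ + η' ≤ R'`, hence `p ∈ S` within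
`η'`, `‖p − q‖ ≤ 2 + 2η' ≤ ρ`, hence `p' ∈ T` with `dist(p − q, p') ≤ ζ` and `dist(x j' − x j, p') ≤ 2η' + ζ ≤ η`.
May fail only through a bookkeeping slip in the radii (all three slacks are explicit hypotheses). [folklore] -/
theorem stub_nearGood :
    ∀ (R' η' ζ ρ η : ℝ), 0 ≤ η' → η' ≤ 1 → 0 ≤ ζ → ζ ≤ 1 → 2 * η' + ζ ≤ η → 2 + η ≤ ρ →
    ∀ (N : ℕ) (x : Fin N → E3) (i : Fin N) (M : E3 →L[ℝ] E3) (a : ℝ) (A : E3 →ₗᵢ[ℝ] E3) (s : ℤ → ℤ)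
      (z : ℤ → ℝ), 47 / 50 ≤ a → a ≤ 1 → IsHaggSeq s →
      (∀ m : ℤ, 39 / 50 * a ≤ z (m + 1) - z m ∧ z (m + 1) - z m ≤ 17 / 20 * a) →
      let S : Set E3 := {p | ∃ m k l : ℤ, p = A (M (((k : ℝ) • triangularVec₁ a) + ((l : ℝ) • triangularVec₂ a) +
        ((haggLabel s m : ℝ) • barlowOffset a) + (z m • layerNormal 1)))}
      (∀ p ∈ S, ‖p‖ ≤ R' → ∃ j : Fin N, dist (x j - x i) p ≤ η') →
      (∀ j : Fin N, ‖x j - x i‖ ≤ R' → ∃ p ∈ S, dist (x j - x i) p ≤ η') →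
      ∀ (j : Fin N) (q : E3), q ∈ S → dist (x j - x i) q ≤ η' → ‖q‖ + ρ + 1 ≤ R' → Near ζ ρ S q →
        LayeredGood 2 η x j := by
  sorry

/-- **Stub 3 — strain selection along ground states (Lennard-Jones block accounting; load-bearing analysis).**
Given the elastic gap at allowance `κ ∈ (0, 1/4]` and Stub 2: along every sequence of Lennard-Jones ground states
whose `κ`-affine defects are sparse at every scale (`FewAffBad κ`), the radius-`2` FLOOR defects are sparse too — for
every `η, θ > 0`, eventually at most `θN` sites are not two-way `(2, η)`-layered-good.  Intended proof: fix the
locality `ζ := η/2`, `ρ := 3 + η`, the gap data `g, C` of Stub 1, a block side `B` and an accounting scale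
`(R', η')` with `R' ≥ 4B + ρ + 2`, `η' ≤ min (η/4) (δ/8)` (`δ` from `LennardJonesMinimalDistance_holds`); by
`FewAffBad`, eventually all but `θ'N` sites are `κ`-affine-good at `(R', η')`.  Tile space by `B`-cubes; a cube
met by the `R'/2`-ball of an affine-good site `i` inherits its strained template `S_i`: template points are
`≥ (1 − κ)·0.9 ≥ 0.67` apart (`κ ≤ 1/4`; in-box spacing and gaps), so particles of the cube are in BIJECTION with
the template points `W` of the cube (`η' < δ/8`), and `Σ_{j ∈ cube} siteE_j(x_N) ≥ Σ_{p∈W} e_p(S_i) − #W·ω(η', B)`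
(Lipschitz bound of `V` on `[δ/2, ∞)`, tails `Σ_{|q| > B} |q|⁻⁶`; `ω → 0` as `η' → 0`, `B → ∞`, uniformly in the
admissible strained data).  By Stub 1 the cube pays `≥ 2e*·#W + 2g·#{non-Near points of W} − C·C'B²`; by Stub 2
every particle matched to a `Near` point is `(2, η)`-layered-good.  Cubes met by no good ball hold only
`θ'`-budgeted sites with `siteE ≥ −C₀` (stability of `V_LJ` on `δ`-separated sets).  Summing and comparing with
`2E(x_N) ≤ 2N·e* + o(N)` (`crysEnergyLimit`, `IsGroundState`):
`2g·#{particles matched to non-Near points} ≤ o(N) + N·(2ω + C C'/B + C₁ θ')`, which is `≤ θN/2` for `B`, `1/η'`,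
`1/θ'` large; the remaining non-good particles are the `≤ θ'N` unbudgeted ones and those within `ρ + 2` of a cube
face not covered from inside (absorbed by taking the covering ball of radius `R'/2 ≥ 2B`).  May fail through the
bookkeeping of cubes met by two differently-strained good balls (two templates matching the same particles on the
overlap agree up to `2η'` there, so the cube may be charged to either), or if `ω` were not uniform in the strain
(it is for `κ ≤ 1/4`: separation `≥ 0.67` and density `≤ 4` of the strained template are uniform). [conjecture] -/
theorem stub_affineSelection : ∀ κ : ℝ, 0 < κ → κ ≤ 1 / 4 → AffineGapAt κ → Sig.stub_nearGood →
    ∀ x : (N : ℕ) → (Fin N → E3), (∀ N, IsGroundState lennardJones (x N)) → FewAffBad κ x →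
      ∀ η θ : ℝ, 0 < η → 0 < θ →
        ∀ᶠ N in atTop, (Nat.card {i : Fin N // ¬ LayeredGood 2 η (x N) i} : ℝ) ≤ θ * N := by
  sorry

/-! ### Sorry-free glue -/

/-- **Counting** (the seed's `eventually_exists_not_bad` with a density): under FLOOR(P₀) (`e(P₀) = e*`,
`floor_iff_eq_eStar`) and the affine-blind budget, `c·#bad ≤ E(N) − N·e*` and `E(N)/N → e*` (`crysEnergyLimit`)
give, for every `θ > 0`, eventually `#bad ≤ θN`. [folklore] -/
theorem fewAffBad_of_budget (κ : ℝ) (P₀ : PeriodicConfiguration 3) (hF : Floor P₀) (hB : AffBudget κ P₀)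
    (x : (N : ℕ) → (Fin N → E3)) (hx : ∀ N, IsGroundState lennardJones (x N)) : FewAffBad κ x := by
  intro R η θ hR hη hθ
  obtain ⟨c, hc, hcB⟩ := hB R η hR hη
  have heq := (Theorems.FluxTubeKeplerFloorGivesLayered.floor_iff_eq_eStar P₀).1 hF
  have hlim := crysEnergyLimit
  have hlt : (⨅ Q : PeriodicConfiguration 3, Q.energyPerParticle lennardJones) < eStar + c * θ := by
    change eStar < eStar + c * θ
    nlinarith
  have hev : ∀ᶠ N : ℕ in atTop, groundStateEnergy lennardJones 3 N / N < eStar + c * θ :=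
    hlim.eventually (gt_mem_nhds hlt)
  filter_upwards [hev, Filter.eventually_gt_atTop 0] with N hN hNpos
  have h1 := hcB N (x N) (hx N)
  rw [heq, (hx N).2] at h1
  have hNr : (0 : ℝ) < N := by exact_mod_cast hNpos
  have h2 : groundStateEnergy lennardJones 3 N < (eStar + c * θ) * N := by
    rwa [div_lt_iff₀ hNr] at hN
  have h3 : c * (Nat.card {i : Fin N // ¬ AffGood κ R η (x N) i} : ℝ) < c * (θ * N) := by
    nlinarith
  exact (lt_of_mul_lt_mul_left h3 hc.le).le

/-- (Verbatim from the sibling lines `Lines/RegistryBlindRung.lean`, `Lines/ScaleBlindRung.lean`.)  **Sparse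
radius-`2` floor defects ⇒ good sites at every scale, frequently** (landed chart gluing
`FluxCellKeplerSingleScale.card_bad_le` at `R₀ = 2`, `δ`-separation of ground states `LennardJonesMinimalDistance_holds`,
and counting). [folklore] -/
theorem good_of_sparse (x : (N : ℕ) → (Fin N → E3)) (hx : ∀ N, IsGroundState lennardJones (x N))
    (hsp : ∀ η θ : ℝ, 0 < η → 0 < θ →
      ∀ᶠ N in atTop, (Nat.card {i : Fin N // ¬ LayeredGood 2 η (x N) i} : ℝ) ≤ θ * N) :
    ∀ R η : ℝ, 0 < R → 0 < η → ∃ᶠ N in atTop, ∃ i : Fin N, LayeredGood R η (x N) i := by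
  intro R η hR hη
  obtain ⟨δ, hδ, hsep⟩ := LennardJonesMinimalDistance_holds
  obtain ⟨η', hη', M, hM, hcard⟩ := card_bad_le (le_refl (2 : ℝ)) hδ R η hη
  have hθ : (0 : ℝ) < 1 / (2 * M) := by positivity
  have hev := (hsp η' (1 / (2 * M)) hη' hθ).and (eventually_ge_atTop 1)
  refine hev.frequently.mono fun N hN => ?_
  obtain ⟨hNsp, hN1⟩ := hN
  by_contra hno
  have hno' : ∀ i : Fin N, ¬ LayeredGood R η (x N) i := fun i hi => hno ⟨i, hi⟩
  have hall : (N : ℝ) ≤ Nat.card {i : Fin N // ¬ LayeredGood R η (x N) i} := by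
    rw [Nat.card_eq_fintype_card, Fintype.card_subtype]
    have : (Finset.univ.filter fun i : Fin N => ¬ LayeredGood R η (x N) i) = Finset.univ :=
      Finset.filter_true_of_mem fun i _ => hno' i
    rw [this, Finset.card_univ, Fintype.card_fin]
  have h1 := hcard N (x N) (hsep N (x N) (hx N))
  have hN1' : (1 : ℝ) ≤ N := by exact_mod_cast hN1
  have hchain : (N : ℝ) ≤ M * (1 / (2 * M) * N) := hall.trans (h1.trans (mul_le_mul_of_nonneg_left hNsp hM.le))
  have hMM : M * (1 / (2 * M) * N) = N / 2 := by field_simp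
  rw [hMM] at hchain
  linarith

open Summit.AtomisticToContinuum.Crystallization.Theorems.FluxTubeKeplerFloorGivesLayered
  (spacing_selection match_dilate layered_pt_scale) in
/-- (Verbatim from the sibling lines `Lines/PosTolRung.lean`, `Lines/VacancyBlindRung.lean`,
`Lines/RegistryBlindRung.lean`, `Lines/ScaleBlindRung.lean`.)  Steps 2–3 of the seed, isolated: good sites at every
scale (with scale-dependent spacings IN THE BOX) give the layered-windows hypothesis of
`FluxTubeKepler.PeriodicGivenLayered` (one spacing by `spacing_selection` — Bolzano–Weierstrass on the compact box,
transfer by dilation `match_dilate` + `layered_pt_scale`, translation `t := −x N i`). [folklore] -/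
theorem hasLayeredWindows_of_good (x : (N : ℕ) → (Fin N → E3))
    (hgood : ∀ R η : ℝ, 0 < R → 0 < η → ∃ᶠ N in atTop, ∃ i : Fin N, LayeredGood R η (x N) i) :
    ∃ a : ℝ, 47 / 50 ≤ a ∧ a ≤ 1 ∧ ∀ R ε : ℝ, 0 < ε → ∃ᶠ N in Filter.atTop,
      ∃ (A : E3 →ₗᵢ[ℝ] E3) (t : E3) (s : ℤ → ℤ) (z : ℤ → ℝ), IsHaggSeq s ∧
      (∀ m : ℤ, 39 / 50 * a ≤ z (m + 1) - z m ∧ z (m + 1) - z m ≤ 17 / 20 * a) ∧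
      let S : Set E3 := {p | ∃ m i j : ℤ, p = A (((i : ℝ) • triangularVec₁ a) +
        ((j : ℝ) • triangularVec₂ a) + ((haggLabel s m : ℝ) • barlowOffset a) + (z m • layerNormal 1))};
      (∀ p ∈ S, ‖p‖ ≤ R → ∃ i : Fin N, dist (x N i + t) p ≤ ε) ∧
      (∀ i : Fin N, ‖x N i + t‖ ≤ R → ∃ p ∈ S, dist (x N i + t) p ≤ ε) := by
  -- Step 2: one spacing for all scales, the transfer being dilation of the whole layered datum
  have hgood' : ∀ R η : ℝ, 0 < R → 0 < η → ∃ᶠ N in atTop, ∃ i : Fin N, ∃ a : ℝ, 47 / 50 ≤ a ∧ a ≤ 1 ∧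
      ∃ (A : E3 →ₗᵢ[ℝ] E3) (s : ℤ → ℤ) (z : ℤ → ℝ), IsHaggSeq s ∧
        (∀ m : ℤ, 39 / 50 * a ≤ z (m + 1) - z m ∧ z (m + 1) - z m ≤ 17 / 20 * a) ∧
        let S : Set E3 := {p | ∃ m k l : ℤ, p = A (((k : ℝ) • triangularVec₁ a) +
          ((l : ℝ) • triangularVec₂ a) + ((haggLabel s m : ℝ) • barlowOffset a) + (z m • layerNormal 1))};
        (∀ p ∈ S, ‖p‖ ≤ R → ∃ j : Fin N, dist (x N j - x N i) p ≤ η) ∧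
        (∀ j : Fin N, ‖x N j - x N i‖ ≤ R → ∃ p ∈ S, dist (x N j - x N i) p ≤ η) := hgood
  obtain ⟨a, ha1, ha2, hwin⟩ := spacing_selection hgood' fun R ε hR hε => by
    obtain ⟨η₁, hη₁0, hη₁ε, hη₁1⟩ : ∃ η₁ : ℝ, 0 < η₁ ∧ η₁ ≤ ε ∧ η₁ ≤ 1 :=
      ⟨min ε 1, lt_min hε one_pos, min_le_left _ _, min_le_right _ _⟩
    have hR1 : 0 < R + 1 := by linarith
    obtain ⟨θ, hθ0, hθR⟩ : ∃ θ : ℝ, 0 < θ ∧ θ * (R + 1) = η₁ / 2 :=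
      ⟨η₁ / 2 / (R + 1), by positivity, by field_simp⟩
    refine ⟨47 / 50 * θ, by positivity, R + 1, η₁ / 2, by positivity, ?_⟩
    intro a b R' η' ha hb hab hRR' hη' N i hG
    obtain ⟨A, s, z, hs, hbox, hM₁, hM₂⟩ := hG
    have ha0 : 0 < a := by linarith
    have hb0 : 0 < b := by linarith
    obtain ⟨ρ, hρ0, hρb⟩ : ∃ ρ : ℝ, 0 < ρ ∧ ρ * b = a :=
      ⟨a / b, div_pos ha0 hb0, div_mul_cancel₀ a hb0.ne'⟩
    have habs : |b - a| < 47 / 50 * θ := hab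
    have h1ρ : |1 - ρ| ≤ θ := by
      have e1 : 1 - ρ = (b - a) / b := by rw [← hρb]; field_simp
      rw [e1, abs_div, abs_of_pos hb0, div_le_iff₀ hb0]
      nlinarith [abs_nonneg (b - a)]
    have h1ρ' : |ρ⁻¹ - 1| ≤ θ := by
      have e1 : ρ⁻¹ - 1 = (b - a) / a := by rw [← hρb]; field_simp
      rw [e1, abs_div, abs_of_pos ha0, div_le_iff₀ ha0]
      nlinarith [abs_nonneg (b - a)]
    refine ⟨A, s, fun m => ρ * z m, hs, fun m => ?_, ?_⟩
    · obtain ⟨hl, hu⟩ := hbox m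
      have hl' := mul_le_mul_of_nonneg_left hl hρ0.le
      have hu' := mul_le_mul_of_nonneg_left hu hρ0.le
      constructor
      · calc 39 / 50 * a = ρ * (39 / 50 * b) := by rw [← hρb]; ring
          _ ≤ ρ * (z (m + 1) - z m) := hl'
          _ = ρ * z (m + 1) - ρ * z m := by ring
      · calc ρ * z (m + 1) - ρ * z m = ρ * (z (m + 1) - z m) := by ring
          _ ≤ ρ * (17 / 20 * b) := hu'
          _ = 17 / 20 * a := by rw [← hρb]; ring
    · have hscale : ∀ m k l : ℤ, A (((k : ℝ) • triangularVec₁ a) + ((l : ℝ) • triangularVec₂ a) +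
          ((haggLabel s m : ℝ) • barlowOffset a) + ((ρ * z m) • layerNormal 1)) =
          ρ • A (((k : ℝ) • triangularVec₁ b) + ((l : ℝ) • triangularVec₂ b) +
          ((haggLabel s m : ℝ) • barlowOffset b) + (z m • layerNormal 1)) := by
        intro m k l
        rw [← hρb]
        exact layered_pt_scale A ρ b s z m k l
      dsimp only
      refine match_dilate (fun j => x N j - x N i) _ _ hθ0 hθR hη₁ε hη₁1 hρ0 h1ρ h1ρ' hRR' hη'
        ?_ ?_ hM₁ hM₂
      · rintro p ⟨m, k, l, rfl⟩
        exact ⟨m, k, l, (hscale m k l).symm⟩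
      · rintro p' ⟨m, k, l, rfl⟩
        exact ⟨_, ⟨m, k, l, rfl⟩, hscale m k l⟩
  -- Step 3: read the fixed-spacing good site at radius `max R 1` and translate by `t := -x N i`
  refine ⟨a, ha1, ha2, fun R ε hε => ?_⟩
  have hR' : 0 < max R 1 := lt_max_of_lt_right one_pos
  refine (hwin (max R 1) ε hR' hε).mono fun N hN => ?_
  obtain ⟨i, hi⟩ := hN
  obtain ⟨A, s, z, hs, hbox, hM₁, hM₂⟩ := hi
  refine ⟨A, -x N i, s, z, hs, hbox, ?_⟩
  have hsub : ∀ j : Fin N, x N j + -x N i = x N j - x N i := fun j =>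
    (sub_eq_add_neg (x N j) (x N i)).symm
  intro S
  refine ⟨fun p hp hpR => ?_, fun j hj => ?_⟩
  · obtain ⟨j, hj⟩ := hM₁ p hp (hpR.trans (le_max_left R 1))
    exact ⟨j, by rw [hsub j]; exact hj⟩
  · rw [hsub j] at hj ⊢
    exact hM₂ j (hj.trans (le_max_left R 1))

/-! ### The skeleton theorem: the rung BY NAME from the three stub statements (sorry-free) -/

/-- **Assembly.** `stub_affineGap → stub_nearGood → stub_affineSelection → AffineBlindRung`: Stub 1 names the
strain allowance `κ₀`; under FLOOR and the `κ₀`-affine-blind budget the affine defects are sparse at every scale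
(`fewAffBad_of_budget`); stubs 1+2+3 make the radius-`2` floor defects sparse along the sequence; the landed chart
gluing turns sparsity into floor-good sites at every scale (`good_of_sparse`), hence layered windows
(`hasLayeredWindows_of_good`) and periodic windows (proved `PeriodicGivenLayered`). -/
theorem AffineBlindRung_of (h₁ : Sig.stub_affineGap) (h₂ : Sig.stub_nearGood) (h₃ : Sig.stub_affineSelection) :
    AffineBlindRung := by
  obtain ⟨κ, hκ, hκ4, hgap⟩ := h₁
  refine ⟨κ, hκ, fun P₀ hF hB x hx => ?_⟩
  have hsp := h₃ κ hκ hκ4 hgap h₂ x hx (fewAffBad_of_budget κ P₀ hF hB x hx)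
  have hgood := good_of_sparse x hx hsp
  exact Theses.FluxTubeKepler.PeriodicGivenLayered_holds x hx (hasLayeredWindows_of_good x hgood)

/-- **The closed skeleton instance**: the rung by name from the three declared stubs (the only `sorry`s of this
file enter here). [conjecture] -/
theorem AffineBlindRung_skeleton : AffineBlindRung :=
  AffineBlindRung_of stub_affineGap stub_nearGood stub_affineSelection

end Summit.AtomisticToContinuum.Crystallization.Cruxes.FluxCellKepler.AffineLadder

end
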